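import Literature.Geometry.Lorentzian.KerrSchildFrame
import Summits.FinalStateConjecture.FinalStateConjecture.Theorems.BartnikGapSettlingGapExhaustionLorentzNormalisation
import Summits.FinalStateConjecture.FinalStateConjecture.Theorems.BartnikGapSettlingGapExhaustionMetricInCoordsCompAffine
import HarnessLib

/-!
# Crux `GapExhaustion` (stmt-FinalStateConjecture-10808), line `photon-shell-pseudoconvexity`:
# stub (N-6a) `stub_ikFrameNormalisation` — the EXACT Lorentz frame of a near-Kerr symmetric form
# at a point of the star domain

Route `BartnikGapSettling`; helper (`--supports stmt-FinalStateConjecture-10808`) of line lead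
c10, first of the four files cashing the claim "S5 = Ionescu–Klainerman's local extension theorem
+ landed bricks": IK's chart form asks `G p = η` EXACTLY at the centre of the ball. For `0 < M`
there is `δF > 0` such that every symmetric bilinear form `S₀` within `δF` of the Kerr–Schild form
`g_{M,a}(x)`, `r_a(x) > M`, is exactly Minkowski in a frame `L` with `‖L‖, ‖L⁻¹‖ ≤ 6`: read `S₀`
in the Kerr–Schild frame `A_x` (`g_{M,a}(A·, A·) = η`, `Literature/…/KerrSchildFrame.lean`,
`‖A_x‖, ‖A_x⁻¹‖ ≤ 1 + 2|M|/M = 3` on `{r > M}`), where it is `9 δF`-close to `η`, then correct by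
the near-identity change of frame of `stub_lorentzNormalisation` (p133042). Plus four small
operator-norm / equivalence helpers used by the later files.
-/

noncomputable section

set_option maxSynthPendingDepth 3

-- D-0017: single-problem summit, `Summit.<S>.<S>.…` by design (cf. lakefile `weak.linter.dupNamespace`).
set_option linter.dupNamespace false

namespace Summit.FinalStateConjecture.FinalStateConjecture.Theorems

open Set Function Metric
open Literature.Geometry.Lorentzian
open scoped Manifold ContDiff Topology ENNReal

/-! ### Helpers -/

/-- A continuous linear equivalence from a pair of mutually inverse continuous linear maps.
[folklore] -/
theorem ikStep_exists_equiv (A B : E4 →L[ℝ] E4) (hAB : A.comp B = ContinuousLinearMap.id ℝ E4)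
    (hBA : B.comp A = ContinuousLinearMap.id ℝ E4) :
    ∃ L : E4 ≃L[ℝ] E4, (L : E4 →L[ℝ] E4) = A ∧ (L.symm : E4 →L[ℝ] E4) = B := by
  refine ⟨ContinuousLinearEquiv.equivOfInverse A B (fun v ↦ ?_) (fun v ↦ ?_), rfl, rfl⟩
  · simpa using DFunLike.congr_fun hBA v
  · simpa using DFunLike.congr_fun hAB v

/-- Scaling a continuous linear equivalence by `s ≠ 0`. [folklore] -/
theorem ikStep_exists_smul_equiv (L : E4 ≃L[ℝ] E4) {s : ℝ} (hs : s ≠ 0) :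
    ∃ Ls : E4 ≃L[ℝ] E4, (Ls : E4 →L[ℝ] E4) = s • (L : E4 →L[ℝ] E4) ∧
      (Ls.symm : E4 →L[ℝ] E4) = s⁻¹ • (L.symm : E4 →L[ℝ] E4) := by
  refine ikStep_exists_equiv _ _ ?_ ?_
  · ext v
    simp [smul_smul, inv_mul_cancel₀ hs]
  · ext v
    simp [smul_smul, mul_inv_cancel₀ hs]

/-- Lower bound of an operator norm through an invertible right factor:
`‖T‖ ≤ ‖T ∘ L‖ ‖L⁻¹‖`. [folklore] -/
theorem ikStep_norm_le_norm_comp_mul (T : E4 →L[ℝ] ℝ) (L : E4 ≃L[ℝ] E4) :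
    ‖T‖ ≤ ‖T.comp (L : E4 →L[ℝ] E4)‖ * ‖(L.symm : E4 →L[ℝ] E4)‖ := by
  have h : T = (T.comp (L : E4 →L[ℝ] E4)).comp (L.symm : E4 →L[ℝ] E4) := by
    ext v; simp
  conv_lhs => rw [h]
  exact ContinuousLinearMap.opNorm_comp_le _ _

/-- `‖v‖ ≤ ‖L⁻¹‖ ‖L v‖` for a continuous linear equivalence. [folklore] -/
theorem ikStep_norm_le_mul_norm_apply (L : E4 ≃L[ℝ] E4) (v : E4) :
    ‖v‖ ≤ ‖(L.symm : E4 →L[ℝ] E4)‖ * ‖L v‖ := by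
  have h : v = (L.symm : E4 →L[ℝ] E4) (L v) := by simp
  conv_lhs => rw [h]
  exact ContinuousLinearMap.le_opNorm _ _

/-- **Frame normalisation at a point of the star domain.** For `0 < M` there is `δF > 0` such
that every symmetric bilinear form `S₀` on `E4` within `δF` of the Kerr–Schild form
`g_{M,a}(x)` at a point with `r_a(x) > M` is EXACTLY Minkowski in some frame `L` with
`‖L‖, ‖L⁻¹‖ ≤ 6`: `S₀ (L v) (L w) = η(v, w)`. Proof: read `S₀` in the Kerr–Schild frame `A_x`
(`g_{M,a}(A·, A·) = η`, `‖A_x‖, ‖A_x⁻¹‖ ≤ 3` on `{r > M}`), then correct by the near-identity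
change of frame of `stub_lorentzNormalisation`. [folklore] -/
theorem stub_ikFrameNormalisation :
    ∀ (M a : ℝ), 0 < M → ∃ δF : ℝ, 0 < δF ∧
      ∀ (S₀ : E4 →L[ℝ] E4 →L[ℝ] ℝ) (x : E4), M < Kerr.radius a x →
        (∀ v w : E4, S₀ v w = S₀ w v) → ‖S₀ - Kerr.bilin M a x‖ ≤ δF →
        ∃ L : E4 ≃L[ℝ] E4, (∀ v w : E4, S₀ (L v) (L w) = Minkowski.bilin v w) ∧
          ‖(L : E4 →L[ℝ] E4)‖ ≤ 6 ∧ ‖(L.symm : E4 →L[ℝ] E4)‖ ≤ 6 := by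
  intro M a hM
  obtain ⟨δN, hδN, hN⟩ := stub_lorentzNormalisation
  refine ⟨δN / 9, by positivity, ?_⟩
  intro S₀ x hx hS₀ hclose
  have hr0 : 0 < Kerr.radius a x := hM.trans hx
  have hreg : x ∈ (Kerr.region a M : Set E4) := by
    show max M 0 < Kerr.radius a x
    rw [max_eq_left hM.le]; exact hx
  set A : E4 →L[ℝ] E4 := Kerr.ksFrameInvMap M a x with hAdef
  set B : E4 →L[ℝ] E4 := Kerr.ksFrameMap M a x with hBdef
  have hA3 : ‖A‖ ≤ 3 := by
    have h := Kerr.norm_ksFrameInvMap_le M hM hreg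
    have h' : 1 + 2 * |M| / M = 3 := by rw [abs_of_pos hM]; field_simp; ring
    simpa [hAdef, h'] using h
  have hB3 : ‖B‖ ≤ 3 := by
    have h := Kerr.norm_ksFrameMap_le M hM hreg
    have h' : 1 + 2 * |M| / M = 3 := by rw [abs_of_pos hM]; field_simp; ring
    simpa [hBdef, h'] using h
  obtain ⟨Aeq, hAeq, hAeqs⟩ := ikStep_exists_equiv A B
    (by simpa [hAdef, hBdef] using Kerr.ksFrameInvMap_comp_ksFrameMap M a hr0)
    (by simpa [hAdef, hBdef] using Kerr.ksFrameMap_comp_ksFrameInvMap M a hr0)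
  -- `S₀` read in the Kerr–Schild frame
  set S : E4 →L[ℝ] E4 →L[ℝ] ℝ := S₀.bilinearComp A A with hSdef
  have hSsym : ∀ v w : E4, S v w = S w v := fun v w ↦ by
    simp only [hSdef, ContinuousLinearMap.bilinearComp_apply, hS₀ (A v) (A w)]
  have hSclose : ‖S - Minkowski.bilin‖ ≤ δN := by
    obtain ⟨Bc, hBc, hBcG⟩ := compAffine_exists_bilinearCompCLM A
    have hdiff : S - Minkowski.bilin = Bc (S₀ - Kerr.bilin M a x) := by
      rw [map_sub, hBcG, hBcG]
      ext v w
      simp only [hSdef, sub_apply, ContinuousLinearMap.bilinearComp_apply,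
        hAdef, Kerr.bilin_ksFrameInvMap M a hr0]
    rw [hdiff]
    calc ‖Bc (S₀ - Kerr.bilin M a x)‖ ≤ ‖Bc‖ * ‖S₀ - Kerr.bilin M a x‖ := Bc.le_opNorm _
      _ ≤ (‖A‖ * ‖A‖) * (δN / 9) := by gcongr
      _ ≤ (3 * 3) * (δN / 9) := by gcongr
      _ = δN := by ring
  obtain ⟨C, hC, hC2, hCs2⟩ := hN S hSsym hSclose
  refine ⟨C.trans Aeq, fun v w ↦ ?_, ?_, ?_⟩
  · have h := hC v w
    simp only [hSdef, ContinuousLinearMap.bilinearComp_apply] at h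
    simpa [ContinuousLinearEquiv.trans_apply, ← hAeq] using h
  · refine ContinuousLinearMap.opNorm_le_bound _ (by norm_num) fun v ↦ ?_
    have h1 : (C.trans Aeq : E4 →L[ℝ] E4) v = A (C v) := by
      simp [ContinuousLinearEquiv.trans_apply, ← hAeq]
    rw [h1]
    calc ‖A (C v)‖ ≤ ‖A‖ * ‖(C : E4 →L[ℝ] E4) v‖ := A.le_opNorm _
      _ ≤ ‖A‖ * (‖(C : E4 →L[ℝ] E4)‖ * ‖v‖) := by gcongr; exact (C : E4 →L[ℝ] E4).le_opNorm v
      _ ≤ 3 * (2 * ‖v‖) := by gcongr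
      _ = 6 * ‖v‖ := by ring
  · refine ContinuousLinearMap.opNorm_le_bound _ (by norm_num) fun v ↦ ?_
    have h1 : ((C.trans Aeq).symm : E4 →L[ℝ] E4) v = (C.symm : E4 →L[ℝ] E4) (B v) := by
      simp [ContinuousLinearEquiv.symm_trans_apply, ← hAeqs]
    rw [h1]
    calc ‖(C.symm : E4 →L[ℝ] E4) (B v)‖ ≤ ‖(C.symm : E4 →L[ℝ] E4)‖ * ‖B v‖ :=
          (C.symm : E4 →L[ℝ] E4).le_opNorm _
      _ ≤ ‖(C.symm : E4 →L[ℝ] E4)‖ * (‖B‖ * ‖v‖) := by gcongr; exact B.le_opNorm v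
      _ ≤ 2 * (3 * ‖v‖) := by gcongr
      _ = 6 * ‖v‖ := by ring

end Summit.FinalStateConjecture.FinalStateConjecture.Theorems

end
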